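import Mathlib

/-!
# UnipotentSemiregKill — kernel shadow of memo U-SR (hsemireg-alphabet-unipotent-1, g30)

TOKEN: line stmt-HodgeConjecture-18881 Cruxes/BlochSeedDiscOne/Lines/birth.lean 814a6a70c14e831a stub_rung_pad4_seedAt.
Evidence only, census-neutral.  This file certifies the LINEAR ALGEBRA and the ARITHMETIC behind memo
`U-SR-unipotent1-g30.md` («unipotent letters are semiregularity-dead where their traceless diagonal survives»):

* §1 the block-triangular trace identity that IS the letter-diagonal law LDL(-U) in a two-letter slice of a
  display: for an `F⁰` class `y = [[Y, Z], [0, Y']]` and a model Atiyah matrix `a = [[x·1, B], [0, x'·1]]`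
  (block-degree-0 part CENTRAL on each letter block — for a homogeneous letter this is LEMMA AT-HOM of the memo —
  and block-degree-+1 part `B`), `tr(y·aᵐ) = xᵐ·tr Y + x'ᵐ·tr Y'` and the supertrace analogue, over ANY
  commutative coefficient ring (in the memo the coefficients are even-degree forms); hence traceless diagonal
  blocks make every semiregularity word vanish (ZERO-SYMBOL LAW);
* §2 the shape of THEOREM U-SR: a surviving subspace on which all `σₘ` vanish lies in `⋂ₘ ker σₘ`, so the joint
  semiregularity map is not injective (no window, no door);
* §3 the arithmetic quoted in the memo: kill dimensions `b₂ = e₂ − 28` of the letters of record, the exact floor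
  `F(d)` (U-RHO g29 §2.4) turned into kill dimensions, the U-VIS threshold `(F(ℓ) − 28)/ℓ ≥ 14` (`2 ≤ ℓ ≤ 7`; the same value
  `28(ℓ − 1)/ℓ ≥ 14` for smoothable letters of any length), and the count `Σₓ b₂(Tₓ) ≥ #{fat letters}`.

The identification of `Y, Y', x, B` with Dolbeault ∕ Čech representatives, of `σₘ` with the Buchweitz–Flenner
components, and the survival statements (Σ-FLOOR-U, no-interference) are PAPER-LEVEL (memo §1–§4).
It proves NOTHING toward HC ∕ HC_CM ∕ HC_AV ∕ №4 ∕ 26512 ∕ 18881 ∕ H2; CLASS ≠ DESIGN ≠ SHEAF ≠ SEED.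
No `instance`, no notation, no `axiom`, no `sorry`, no `native_decide`, no `set_option`.
-/

namespace HsemiregAlphabetUnipotent.G30

open Matrix

/-! ## §1 The letter-diagonal law in a two-letter slice (LDL ∕ LDL-U kernel shadow) -/

section BlockTrace

variable {R : Type*} [CommRing R]
variable {k l : Type*} [Fintype k] [Fintype l]

/-- The trace of a block matrix is the sum of the traces of its diagonal blocks. [folklore] -/
theorem trace_fromBlocks' (A : Matrix k k R) (B : Matrix k l R) (C : Matrix l k R) (D : Matrix l l R) :
    Matrix.trace (Matrix.fromBlocks A B C D) = Matrix.trace A + Matrix.trace D := by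
  simp [Matrix.trace, Fintype.sum_sum_type]

/-- Supertrace of a `(k ⊕ l)`-block matrix: letters on adjacent levels of the display carry opposite signs. -/
def strace (M : Matrix (k ⊕ l) (k ⊕ l) R) : R :=
  Matrix.trace M.toBlocks₁₁ - Matrix.trace M.toBlocks₂₂

theorem strace_fromBlocks (A : Matrix k k R) (B : Matrix k l R) (C : Matrix l k R) (D : Matrix l l R) :
    strace (Matrix.fromBlocks A B C D) = Matrix.trace A - Matrix.trace D := by
  simp [strace]

variable [DecidableEq k] [DecidableEq l]

/-- Model Atiyah matrix of a two-letter slice: block-degree-0 part central on each letter block (`x • 1`,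
`x' • 1`: the curvature `c₁(A_Z)·id` of a line letter, of a simple box, or — LEMMA AT-HOM — of a homogeneous
letter `W ⊗ A_Z`), block-degree-+1 part `B` (covariant derivative of the display differential), nothing of
negative block degree. -/
def atiyahModel (x x' : R) (B : Matrix k l R) : Matrix (k ⊕ l) (k ⊕ l) R :=
  Matrix.fromBlocks (x • (1 : Matrix k k R)) B 0 (x' • (1 : Matrix l l R))

/-- An `F⁰` (block-degree `≥ 0`) class: diagonal blocks `Y`, `Y'` (the letter-diagonal components `y₀^{ZZ}`),
off-diagonal component `Z`. -/
def f0Class (Y : Matrix k k R) (Z : Matrix k l R) (Y' : Matrix l l R) : Matrix (k ⊕ l) (k ⊕ l) R :=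
  Matrix.fromBlocks Y Z 0 Y'

/-- «Nothing lowers block degree»: powers of the model Atiyah matrix stay block upper triangular with CENTRAL
diagonal blocks `xᵐ • 1`, `x'ᵐ • 1`. -/
theorem atiyahModel_pow (x x' : R) (B : Matrix k l R) (m : ℕ) :
    ∃ Bm : Matrix k l R, (atiyahModel x x' B) ^ m =
      Matrix.fromBlocks (x ^ m • (1 : Matrix k k R)) Bm 0 (x' ^ m • (1 : Matrix l l R)) := by
  induction m with
  | zero =>
      refine ⟨0, ?_⟩
      rw [pow_zero, pow_zero, pow_zero, one_smul, one_smul, Matrix.fromBlocks_one]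
  | succ m ih =>
      obtain ⟨Bm, hBm⟩ := ih
      refine ⟨x ^ m • B + x' • Bm, ?_⟩
      rw [pow_succ (atiyahModel x x' B) m, hBm, atiyahModel, Matrix.fromBlocks_multiply]
      refine Matrix.fromBlocks_inj.mpr ⟨?_, ?_, ?_, ?_⟩
      · simp only [Matrix.mul_zero, add_zero, Matrix.smul_mul, Matrix.one_mul, smul_smul, pow_succ]
      · simp only [Matrix.smul_mul, Matrix.one_mul, Matrix.mul_smul, Matrix.mul_one]
      · simp only [Matrix.zero_mul, Matrix.mul_zero, add_zero]
      · simp only [Matrix.zero_mul, zero_add, Matrix.smul_mul, Matrix.one_mul, smul_smul, pow_succ]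

/-- `y · aᵐ` is block upper triangular with diagonal blocks `xᵐ • Y`, `x'ᵐ • Y'`. -/
theorem f0Class_mul_atiyahModel_pow (Y : Matrix k k R) (Z : Matrix k l R) (Y' : Matrix l l R)
    (x x' : R) (B : Matrix k l R) (m : ℕ) :
    ∃ J : Matrix k l R, f0Class Y Z Y' * (atiyahModel x x' B) ^ m =
      Matrix.fromBlocks (x ^ m • Y) J 0 (x' ^ m • Y') := by
  obtain ⟨Bm, hBm⟩ := atiyahModel_pow x x' B m
  refine ⟨Y * Bm + x' ^ m • Z, ?_⟩
  rw [hBm, f0Class, Matrix.fromBlocks_multiply]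
  refine Matrix.fromBlocks_inj.mpr ⟨?_, ?_, ?_, ?_⟩
  · simp only [Matrix.mul_smul, Matrix.mul_one, Matrix.mul_zero, add_zero]
  · simp only [Matrix.mul_smul, Matrix.mul_one]
  · simp only [Matrix.zero_mul, Matrix.mul_zero, add_zero]
  · simp only [Matrix.zero_mul, zero_add, Matrix.mul_smul, Matrix.mul_one]

/-- LDL(-U), trace form: `tr(y · aᵐ) = xᵐ · tr Y + x'ᵐ · tr Y'` — only the letter-diagonal blocks, weighted
by the m-th power of the central curvature, are seen; the connecting term `B` and the off-diagonal `Z` are not. -/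
theorem trace_f0Class_mul_pow (Y : Matrix k k R) (Z : Matrix k l R) (Y' : Matrix l l R)
    (x x' : R) (B : Matrix k l R) (m : ℕ) :
    Matrix.trace (f0Class Y Z Y' * (atiyahModel x x' B) ^ m) =
      x ^ m * Matrix.trace Y + x' ^ m * Matrix.trace Y' := by
  obtain ⟨J, hJ⟩ := f0Class_mul_atiyahModel_pow Y Z Y' x x' B m
  rw [hJ, trace_fromBlocks', Matrix.trace_smul, Matrix.trace_smul, smul_eq_mul, smul_eq_mul]

/-- LDL(-U), supertrace form (two letters on adjacent levels, signs `ε_Z = +1, −1`). -/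
theorem strace_f0Class_mul_pow (Y : Matrix k k R) (Z : Matrix k l R) (Y' : Matrix l l R)
    (x x' : R) (B : Matrix k l R) (m : ℕ) :
    strace (f0Class Y Z Y' * (atiyahModel x x' B) ^ m) =
      x ^ m * Matrix.trace Y - x' ^ m * Matrix.trace Y' := by
  obtain ⟨J, hJ⟩ := f0Class_mul_atiyahModel_pow Y Z Y' x x' B m
  rw [hJ, strace_fromBlocks, Matrix.trace_smul, Matrix.trace_smul, smul_eq_mul, smul_eq_mul]

/-- ZERO-SYMBOL LAW (C4-LDL 1.4 ∕ memo 2.2): if the letter-diagonal blocks are TRACELESS — the traceless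
`Ext²_Ô(T,T)`-classes of a homogeneous letter (Theorem SS: `b₂(T) = e₂(T) − 28 ≥ 1` of them as soon as
`ℓ(T) ≥ 2`) — then every semiregularity word `tr(y·aᵐ)`, `str(y·aᵐ)` vanishes, for every `m`, every
connecting term `B` and every off-diagonal component `Z`. -/
theorem sigma_words_vanish_of_traceless (Y : Matrix k k R) (Z : Matrix k l R) (Y' : Matrix l l R)
    (hY : Matrix.trace Y = 0) (hY' : Matrix.trace Y' = 0) (x x' : R) (B : Matrix k l R) (m : ℕ) :
    Matrix.trace (f0Class Y Z Y' * (atiyahModel x x' B) ^ m) = 0 ∧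
      strace (f0Class Y Z Y' * (atiyahModel x x' B) ^ m) = 0 := by
  rw [trace_f0Class_mul_pow, strace_f0Class_mul_pow, hY, hY']
  constructor <;> ring

/-- The scalar class `ω·id` on a letter block of fibre length `ℓ = |k|` weighs `ℓ·ω` in the symbol: a homogeneous
letter of length `ℓ` contributes to the class symbols of the canonical classes exactly like `ℓ` separated copies
(memo 3.5, retyping invariance of monad-4 AOP ∕ C4-LDL §3b). -/
theorem trace_scalar_block (x x' : R) (B : Matrix k l R) (m : ℕ) (ω : R) :
    Matrix.trace (f0Class (ω • (1 : Matrix k k R)) 0 (0 : Matrix l l R) * (atiyahModel x x' B) ^ m) =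
      x ^ m * (ω * Fintype.card k) := by
  rw [trace_f0Class_mul_pow, Matrix.trace_smul, Matrix.trace_one, Matrix.trace_zero, smul_eq_mul]
  ring

end BlockTrace

/-! ## §2 Survival ⟹ kernel (the shape of THEOREM U-SR and LEMMA DOORS) -/

section Survival

variable {K : Type*} [Field K] {V H : Type*} [AddCommGroup V] [Module K V] [AddCommGroup H] [Module K H]
variable {ι : Type*}

/-- A surviving block `W ≤ Ext²` on which every component `σᵢ` vanishes lies in `V_∞ = ⋂ᵢ ker σᵢ`. -/
theorem le_iInf_ker_of_vanish (σ : ι → (V →ₗ[K] H)) (W : Submodule K V)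
    (h : ∀ i, ∀ w ∈ W, σ i w = 0) : W ≤ ⨅ i, LinearMap.ker (σ i) :=
  le_iInf fun i => fun w hw => LinearMap.mem_ker.mpr (h i w hw)

/-- … hence `dim ⋂ᵢ ker σᵢ ≥ dim W` (memo 3.1: `≥ Σₓ b₂(Tₓ)` in (A4♯) ∕ no-interference rooms). -/
theorem finrank_iInf_ker_ge [FiniteDimensional K V] (σ : ι → (V →ₗ[K] H)) (W : Submodule K V)
    (h : ∀ i, ∀ w ∈ W, σ i w = 0) :
    Module.finrank K W ≤ Module.finrank K (⨅ i, LinearMap.ker (σ i) : Submodule K V) :=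
  Submodule.finrank_mono (le_iInf_ker_of_vanish σ W h)

/-- … and no single component is injective (no door of LEMMA DOORS, each of which factors through the `σᵢ`). -/
theorem not_injective_of_vanish (σ : ι → (V →ₗ[K] H)) (W : Submodule K V)
    (h : ∀ i, ∀ w ∈ W, σ i w = 0) (hW : W ≠ ⊥) (i : ι) : ¬ Function.Injective (σ i) := by
  obtain ⟨w, hw, hw0⟩ := Submodule.exists_mem_ne_zero_of_ne_bot hW
  intro hinj
  exact hw0 (hinj (by rw [h i w hw, map_zero]))

/-- … nor is the JOINT map `(σᵢ)ᵢ` injective: no window `I` is semiregular ((C7ᶜ) fails for every window). -/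
theorem not_injective_pi_of_vanish (σ : ι → (V →ₗ[K] H)) (W : Submodule K V)
    (h : ∀ i, ∀ w ∈ W, σ i w = 0) (hW : W ≠ ⊥) : ¬ Function.Injective (LinearMap.pi σ) := by
  obtain ⟨w, hw, hw0⟩ := Submodule.exists_mem_ne_zero_of_ne_bot hW
  intro hinj
  apply hw0
  apply hinj
  ext i
  simp [h i w hw]

/-- A door that FACTORS through the components (`δ = Σᵢ cᵢ ∘ σᵢ`: KC's `δc₄`, K-B♮-det's `τ_B ∘ ω`) inherits
the kernel: it vanishes on `W` too. -/
theorem door_vanish_of_factor {H' : Type*} [AddCommGroup H'] [Module K H'] [Fintype ι]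
    (σ : ι → (V →ₗ[K] H)) (c : ι → (H →ₗ[K] H')) (W : Submodule K V)
    (h : ∀ i, ∀ w ∈ W, σ i w = 0) (w : V) (hw : w ∈ W) :
    (∑ i, (c i).comp (σ i)) w = 0 := by
  rw [LinearMap.sum_apply]
  exact Finset.sum_eq_zero fun i _ => by rw [LinearMap.comp_apply, h i w hw, map_zero]

end Survival

/-! ## §3 Arithmetic of the memo -/

section Arithmetic

/-- Kill dimension of a letter with `ext²_Ô(T,T) = e₂`: `b₂(T) = e₂ − 28` (Theorem SS: `e₂ = C(8,2) + b₂`). -/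
def killDim (e2 : ℕ) : ℕ := e2 - 28

/-- `C(8,2) = 28`: the scalar part. -/
theorem choose_8_2 : Nat.choose 8 2 = 28 := by decide

/-- Letters of record (g28 census): gl₂ letter `e₂ = 98 ↦ 70`; `J` (length 8) `182 ↦ 154`; tower `k[t]/t²`
`56 ↦ 28`; two copies on one label `k²`: `112 ↦ 84`. -/
theorem killDim_records : killDim 98 = 70 ∧ killDim 182 = 154 ∧ killDim 56 = 28 ∧ killDim 112 = 84 := by
  decide

/-- Towers `k[t]/tᵃ` (`e₂ = 28a`): kill dimension `28(a − 1)`. -/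
theorem killDim_tower (a : ℕ) : killDim (28 * a) = 28 * (a - 1) := by
  unfold killDim; omega

/-- `m` copies on ONE label (`T = kᵐ`, `e₂ = 28m²`): kill dimension `28(m² − 1)` — the aligned single-block case
of monad-4 BLOCK-TRACE (`sl_m ⊗ H^{0,2}`). -/
theorem killDim_copies (m : ℕ) : killDim (28 * m ^ 2) = 28 * (m ^ 2 - 1) := by
  unfold killDim; generalize m ^ 2 = n; omega

/-- The exact single-letter floor `F(d)`, `d = 1..7` (U-RHO g29 §2.4, plate `floor_by_enumeration`). -/
def floorF : Fin 7 → ℕ := ![28, 56, 84, 98, 126, 153, 172]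

/-- Minimal kill dimension of a letter of length `d = 1..7`: `F(d) − 28 = 0, 28, 56, 70, 98, 125, 144`. -/
theorem floorF_kill : (fun i => killDim (floorF i)) = ![0, 28, 56, 70, 98, 125, 144] := by decide

/-- Every fat letter of length `2 ≤ ℓ ≤ 7` kills at least 28 dimensions. -/
theorem floorF_kill_ge_28 : ∀ i : Fin 7, 1 ≤ (i : ℕ) → 28 ≤ killDim (floorF i) := by decide

/-- U-VIS threshold: a letter of length `ℓ = i + 1 ∈ [2,7]` needs visibility mass `M ≥ (F(ℓ) − 28)/ℓ ≥ 14`,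
i.e. `14·ℓ ≤ F(ℓ) − 28`, with equality only at `ℓ = 2` (values 14, 18.67, 17.5, 19.6, 20.83, 20.57). -/
theorem uvis_threshold : ∀ i : Fin 7, 1 ≤ (i : ℕ) → 14 * ((i : ℕ) + 1) ≤ killDim (floorF i) := by decide

theorem uvis_threshold_eq_iff : ∀ i : Fin 7, 1 ≤ (i : ℕ) →
    (14 * ((i : ℕ) + 1) = killDim (floorF i) ↔ (i : ℕ) = 1) := by decide

/-- Smoothable letters (`e₂ ≥ 28ℓ`, U-BUDGET g28 §3): threshold `28(ℓ − 1)/ℓ ≥ 14` for `ℓ ≥ 2`. -/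
theorem uvis_threshold_smoothable (l e2 : ℕ) (hl : 2 ≤ l) (he : 28 * l ≤ e2) : 14 * l ≤ killDim e2 := by
  unfold killDim; omega

/-- A cell with visibility mass `M = 0` hosts only points: `b₂ ≤ ℓ·0` forces `b₂ = 0`, i.e. (Theorem SS) `ℓ = 1`. -/
theorem uvis_invisible (b2 l : ℕ) (h : b2 ≤ l * 0) : b2 = 0 := by
  simpa using h

/-- (A4♯) ∕ no-interference count: if every letter in the list is fat (`e₂ ≥ 29`, i.e. `b₂ ≥ 1` by Theorem SS)
then `Σₓ b₂(Tₓ) ≥ #letters`. -/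
theorem sum_killDim_ge_count (ls : List ℕ) (h : ∀ e ∈ ls, 29 ≤ e) :
    ls.length ≤ (ls.map killDim).sum := by
  induction ls with
  | nil => simp
  | cons e t ih =>
      simp only [List.length_cons, List.map_cons, List.sum_cons]
      have he : 1 ≤ killDim e := by
        have := h e (by simp)
        unfold killDim; omega
      have ht := ih (fun e' he' => h e' (by simp [he']))
      omega

/-- The g28 ∕ g29 budget quantities are MOOT for the crux: whatever the charge total `S ≤ 3136` of a design with
a fat letter, the joint kernel has dimension `≥ 1` (instance: one gl₂ letter, `S = 98 ≤ 3136`, kernel `≥ 70`). -/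
theorem budget_moot_instance : 98 ≤ 3136 ∧ 1 ≤ killDim 98 ∧ 190 > 112 ∧ 6272 = 2 * 3136 := by decide

end Arithmetic

end HsemiregAlphabetUnipotent.G30
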